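import Summits.QuantumFields.YangMills.Theorems.BalabanUVNodesK0FlatPortBodyP
import Summits.QuantumFields.YangMills.Theorems.BalabanUVNodesK0FlatHBBound164P
import Summits.QuantumFields.YangMills.Theorems.UnitScaleTiltProp8FlatCubeSequenceAdm
import HarnessLib

/-!
# K0⁷ `stub_prop8StepCoP13` (stmt-QuantumFields-20541), sub-target S5 — THE S5 SOCKET OF THE ROAD (a)(b)(c): **[Balaban1985Variational] (164) FOR THE CANONICAL FLAT
# `H = GQ*(QGQ*)⁻¹` OF EVERY (2.1)–(2.2)-ADMISSIBLE NESTED FAMILY ON NODE 00's FOUR-TORI `T4Family.P K`, IN THE LEVEL-DEPENDENT-RADII CURRENCY OF THE ONE-STEP FACT,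
# MODULO ONLY THE GEOMETRY (144)∕(2.60) AND THE DATA (160)∕(155)** — the composition, BY NAME, of the d-generic port (`K0FlatPortBodyP.rowsAt_of_adm22`, p596002 ✓:
# the `H`-letters (161)₁ `HDecayLetterD`, (162) `RowSum162`, a distance `dBI ≥ distBI`) with the junction (`K0FlatHBBound164P.rows164_quarter_levelRadii_of_comparable`,
# p594691 ✓: (161) ⇒ (164) under a rate tilt)

Cell `pub-ymgap`, width seat `pub-ymgap-k0-s1-w3` gen 2 (D-0149; START LIST v7 §k0-s1 S5 ROAD; bus INTENT-11).  `--kind proof --supports stmt-QuantumFields-20541 --as helper`;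
count-neutral; def-free; three theorems, nothing restated.  The (144) cube family: dag-n07-e g17's POINTER (INBOX l.27130) — the M-block-saturated tower
`FlatCubeSequenceAligned.cubeSeqM x₀ k hk ρ S M hM : Domains P` with `FlatCubeSequenceAdm.adm22_cubeSeqM : R·M ≤ S → Adm22 (cubeSeqM …) R M` is carrier-generic in the tree
(ym3-torus), so item (i) of this seat's located list is ONE TERM, consumed BY NAME in §3.

THE PRINT (p. 303–304 [PDF 27–28]): *«|HB|, |∇^ηHB|, |∂^{η*}∂^ηHB|, |Δ^ηHB| ≦ B₀ Σ_{c∈ℭ_k} e^{−δ₀d(y₁,c₋)}(L^{j(c)}η)^{−1}|B(c)| < … (161) … Let us take B₃ = 72d³L³B₀ sup … (162)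
It follows from the inequalities (2.47)–(2.51) of [3] that B₃ depends on d and L only. … We may assume that R₁M₁ is sufficiently big, so that B₃e^{−½δ₀R₁M₁} ≦ ½. (163)
Then we get on Δ |HB|, |∇^ηHB|, |∂^{η*}∂^ηHB|, |Δ^ηHB| < ¼M_Δ max{B₃ε₁, ½ε₀}. (164)»*  (p. 302: *«all the operators in this section are taken without any external gauge
field configuration»* — the FLAT `H` of the cube sequence (144), [3] = [Balaban1984PropagatorsII].)

WHAT IS PROVED (sorry-free; axioms standard; no definition).  For every `F : T4Family` (d = 4, odd `L > 11`):
* `hRowsAt_of_adm22_T4` — THERE ARE `M_h⁰, R₀ : ℕ` and `C ≥ 0`, `δ₀ > 0`, `B₃ > 0` such that for all heights `1 ≤ K − n`, `K − n + 1 ≤ F.m + K`, big blocks `M_h = L^{a′} ≥ M_h⁰`,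
  `R ≥ R₀`, `a′ + 3 ≤ F.m + n`, every `D : Domains (F.P K)` with `D.k = K − n`, `Adm22 D R (L·M_h)` and every level-weight family `w`: the `H`-half of the P2 row list
  `HRowsAt (F.P K) (K − n) D w C δ₀ B₃` (guarded (46), the (130) Laplacian row, and `∃ dBI ≥ distBI` with (162) `RowSum162 … dBI w δ₀ B₃` and the four (161)₁ rows
  `HDecayLetterD … dBI w (flatH …) C δ₀`) — `K0FlatPortBodyP.rowsAt_of_adm22` at `d = 3` read on `F.P K = PV 3 ℓ F.m K` (`rfl`), the sign `0 ≤ C` exported;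
* ★ `hbRows164_levelRadii_of_adm22_T4` — the same binders ⇒ THERE IS `dBI ≥ distBI` such that, at every fine bond `b` and for every datum `X` on the index bonds split
  into NEAR cells with `|X(c)| ≤ C_d·M_Δ·ε₁·(dBI(b,c) + 1)·L^{k−j(c)}` ((160) after the triangle inequality) and FAR cells with `|X(c)| ≤ C_d·M_Δ·ε(j(c))·L^{k−j(c)}` at the class
  radius of their own level (`ε n ≤ 2ε(n+1)`), `R ≤ dBI(b,c)` ((144)) and `G·(k − j(c) − g) ≤ dBI(b,c)` ((2.60)), every tilt `0 ≤ τ ≤ ½δ₀` with `2 ≤ e^{τG}` and the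
  displayed (163′) `4C_d·C·B₃·e^{−(½δ₀−τ)R}·2^g ≤ θ`: the four left-weighted rows `|HX|`, `∇^ηHX` (all four directions), `∂^{η*}∂^ηHX`, `Δ^ηHX` of the CANONICAL
  `H := flatH (F.P K) (K − n) D` at `b` are `≤ ¼M_Δ·max{4C_dCB₃·ε₁, θ·ε(k)}` (`k = K − n`) — (164) in the one-step fact's currency, the S6 budget token's S5 letters
  `C := ¼M_Δ·4C_dCB₃`, `θ′ := ¼M_Δθ`.
* ★ `hbRows164_levelRadii_cubeSeq_T4` — §2 AT THE ALIGNED CUBE SEQUENCE (144) `D := cubeSeqM x₀ (K − n) hk ρ S (L·M_h)` around ANY fine base point `x₀` with inner radius `ρ`,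
  collar step `S ≥ R·L·M_h` (print: «dist(□ₙ₊₁, □ₙᶜ) = R₁M₁Lⁿη», [6] p.98 «M a multiple of R₁M₁»): the same conclusion with `Adm22` DISCHARGED by `adm22_cubeSeqM` — (164) for the flat
  `H` OF THE CUBE SEQUENCE on the record's tori, modulo only the level weights' defining equation and the data (160)∕(155).
HONEST SCOPE: the junction to the RECORD — WHICH base point `x₀`∕radius `ρ` (n07-w4's recipe: the core plaquette's fine base point, `center_mem_cubeSet`), the collar
numerics (`R ≥ R₀`, `M_h = L^{a′} ≥ M_h⁰`, `a′ + 3 ≤ F.m + n` vs the record's `ν.M₁` floor — LOCATED-S5-1), WHICH weights `w`, and the data bounds (160)∕(155) themselves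
(S3) — is NOT done here; they are the hypotheses.  The content behind the letters is lit-balaban's kernel-checked
[Balaban1984PropagatorsII] k-level chain (Cor. 2.8, Prop. 2.7, Prop. 2.6, Lemma 2.1), consumed by name through the port.  Count-neutral; K0⁷ OPEN; N07 NOT discharged
(5∕27 unmoved); one finite 𝕋⁴ programme at fixed ε — R4 closes the conditional finite-𝕋⁴ rung `BalabanLadder.UV` only; the YM mass gap (Clay) is NOT proved by any of this;
nothing continuum ∕ ℝ⁴ ∕ OS.

References: T. Bałaban, CMP **102** (1985) 277–309 [Balaban1985Variational] (144) p.300, (155) p.302, (160)–(163) p.303, (164)–(165) p.304; CMP **96** (1984) 223–250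
[Balaban1984PropagatorsII] (2.1)–(2.2) p.224, (2.46) p.231, (2.60) p.234, Cor. 2.8 (2.150)–(2.151) p.249; CMP **109** (1987) 249–301 [Balaban1987RG1] (0.1) p.251.
-/

set_option autoImplicit false

noncomputable section

open scoped BigOperators

namespace Summit.QuantumFields.YangMills.Theorems.K0S5HBRowsAtRecordTori

open Literature.MathematicalPhysics.QuantumFieldTheory.Balaban1983to89
open B6SectADomainsV1 (Domains)
open B6SectAOperatorsV1 (BondIdx dcE dcsE)
open T4Continuum (T4Family)
open Summit.QuantumFields.YangMills.Theorems.FlatCubeOpsText (Adm22 distBI)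
open Summit.QuantumFields.YangMills.Theorems.K0FlatCubeOpsTextP (IsLevWeight flatH HRowsAt hd4 levWeight_nonneg)
open Summit.QuantumFields.YangMills.Theorems.K0FlatPortBodyP (rowsAt_of_adm22)
open Summit.QuantumFields.YangMills.Theorems.K0FlatHBBound164P (rows164_quarter_levelRadii_of_comparable bondIdx_level_le)
open Summit.QuantumFields.YangMills.Theorems.FlatCubeSequenceAligned (cubeSeqM)
open Summit.QuantumFields.YangMills.Theorems.FlatCubeSequenceAdm (adm22_cubeSeqM)

/-- **THE `H`-HALF OF THE P2 ROW LIST ON NODE 00's FOUR-TORI, SIGN OF THE CONSTANT EXPORTED**: for every `F : T4Family` there are `M_h⁰, R₀` and `C ≥ 0`, `δ₀ > 0`,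
`B₃ > 0` such that every (2.1)–(2.2)-admissible nested family `D` on `F.P K` (heights `1 ≤ K − n`, `K − n + 1 ≤ F.m + K`, `M_h = L^{a′} ≥ M_h⁰`, `R ≥ R₀`, `a′ + 3 ≤ F.m + n`,
unit cubes `Λ₀` allowed) and every level-weight family carry `HRowsAt (F.P K) (K − n) D w C δ₀ B₃` for the canonical `flatH`.
[cite: Balaban1985Variational, (46) p.285, (130) p.298, (161)–(162) p.303; Balaban1984PropagatorsII, Cor. 2.8 (2.150)–(2.151) p.249, (2.46) p.231; Balaban1987RG1, (0.1) p.251] -/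
theorem hRowsAt_of_adm22_T4 (F : T4Family) :
    ∃ (Mh₀ R₀ : ℕ) (C δ₀ B₃ : ℝ), 0 ≤ C ∧ 0 < δ₀ ∧ 0 < B₃ ∧
    ∀ (n K : ℕ) (_ : 1 ≤ K - n) (_ : K - n + 1 ≤ F.m + K) {Mh R a' : ℕ} (_ : Mh = F.L ^ a') (_ : Mh₀ ≤ Mh) (_ : R₀ ≤ R) (_ : a' + 3 ≤ F.m + n)
      (D : Domains (F.P K)) (_ : D.k = K - n) (_ : Adm22 D R (F.L * Mh))
      (w : ℕ → PBond (F.P K) 0 → ℝ) (_ : IsLevWeight (F.P K) (K - n) D w),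
      HRowsAt (F.P K) (K - n) D w C δ₀ B₃ := by
  obtain ⟨L, hL, h11, m, hm⟩ := F
  obtain ⟨ℓ, rfl⟩ : ∃ ℓ, L = ℓ + 1 := ⟨L - 1, by omega⟩
  have hℓ : 4 ≤ ℓ := by omega
  obtain ⟨Mh₀, R₀, C, δ₀, B₃, CG, hC, hδ₀, hB₃, -, hmain⟩ := rowsAt_of_adm22 3 ℓ hd4 hL hℓ
  refine ⟨Mh₀, R₀, max C (C * B₃), δ₀, B₃, le_max_of_le_left hC, hδ₀, hB₃, ?_⟩
  intro n K hk1 hk' Mh R a' hMha hMh hR hsize D hDk hAdm w hw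
  exact (hmain m n K hk1 hk' hMha hMh hR hsize D hDk hAdm w hw).1

/-- ★ **(164) FOR THE CANONICAL FLAT `H` OF EVERY ADMISSIBLE NESTED FAMILY ON NODE 00's FOUR-TORI, LEVEL-DEPENDENT FAR RADII** (the S5 socket of the road (a)(b)(c)):
for every `F : T4Family` there are `M_h⁰, R₀` and `C ≥ 0`, `δ₀ > 0`, `B₃ > 0` such that for every admissible family `D` on `F.P K` and level weights `w` (binders of
`hRowsAt_of_adm22_T4`) THERE IS a distance `dBI ≥ distBI` on (fine bond, index bond) pairs for which: at every fine bond `b`, for every datum `X` split into NEAR cells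
(`|X(c)| ≤ C_d·M_Δ·ε₁·(dBI(b,c) + 1)·L^{k−j(c)}`, (160)) and FAR cells (`|X(c)| ≤ C_d·M_Δ·ε(j(c))·L^{k−j(c)}` with `ε n ≤ 2ε(n+1)`, `R ≤ dBI(b,c)`, `G·(k − j(c) − g) ≤ dBI(b,c)`,
(155)∕(144)∕(2.60)), every tilt `0 ≤ τ ≤ ½δ₀` with `2 ≤ e^{τG}`, and (163′) `4C_d·C·B₃·e^{−(½δ₀−τ)R}·2^g ≤ θ` (far coefficient DISPLAYED): the four left-weighted rows of
`H := flatH (F.P K) (K − n) D` at `b` are `≤ ¼M_Δ·max{4C_dCB₃·ε₁, θ·ε(k)}`, `k = K − n`.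
[cite: Balaban1985Variational, (155) p.302, (160)–(164) pp.303–304, (144) p.300; Balaban1984PropagatorsII, (2.60) p.234, Cor. 2.8 (2.150)–(2.151) p.249; Balaban1987RG1, (0.1) p.251] -/
theorem hbRows164_levelRadii_of_adm22_T4 (F : T4Family) :
    ∃ (Mh₀ R₀ : ℕ) (C δ₀ B₃ : ℝ), 0 ≤ C ∧ 0 < δ₀ ∧ 0 < B₃ ∧
    ∀ (n K : ℕ) (_ : 1 ≤ K - n) (_ : K - n + 1 ≤ F.m + K) {Mh R a' : ℕ} (_ : Mh = F.L ^ a') (_ : Mh₀ ≤ Mh) (_ : R₀ ≤ R) (_ : a' + 3 ≤ F.m + n)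
      (D : Domains (F.P K)) (_ : D.k = K - n) (_ : Adm22 D R (F.L * Mh))
      (w : ℕ → PBond (F.P K) 0 → ℝ) (_ : IsLevWeight (F.P K) (K - n) D w),
      ∃ dBI : PBond (F.P K) 0 → BondIdx D → ℝ, (∀ b c, distBI D b c ≤ dBI b c) ∧
      ∀ {Cd MΔ ε₁ R' G θ τ : ℝ} {ε : ℕ → ℝ} {gap : ℕ}
        (_ : 0 ≤ Cd) (_ : 0 ≤ MΔ) (_ : 0 ≤ ε₁) (_ : 0 ≤ ε (K - n)) (_ : ∀ j, j < K - n → ε j ≤ 2 * ε (j + 1))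
        (_ : 0 ≤ τ) (_ : τ ≤ δ₀ / 2) (_ : 2 ≤ Real.exp (τ * G))
        (_ : 4 * Cd * C * B₃ * (Real.exp (-((δ₀ / 2 - τ) * R')) * (2 : ℝ) ^ gap) ≤ θ)
        (near : BondIdx D → Prop) {X : BondIdx D → ℝ} {b : PBond (F.P K) 0}
        (_ : ∀ c, near c → |X c| ≤ Cd * MΔ * ε₁ * ((dBI b c + 1) * ((F.P K).L : ℝ) ^ ((K - n) - (c.1.1 : ℕ))))
        (_ : ∀ c, ¬ near c → |X c| ≤ Cd * MΔ * ε (c.1.1 : ℕ) * ((F.P K).L : ℝ) ^ ((K - n) - (c.1.1 : ℕ)) ∧ R' ≤ dBI b c ∧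
          G * (((K - n : ℕ) : ℝ) - (c.1.1 : ℕ) - gap) ≤ dBI b c),
        w 1 b * (w 1 b * |flatH (F.P K) (K - n) D X b|) ≤ 1 / 4 * MΔ * max (4 * Cd * C * B₃ * ε₁) (θ * ε (K - n)) ∧
        (∀ ν : Fin (F.P K).d, w 1 b * (w 2 b * ((F.P K).L : ℝ) ^ (K - n) *
            |flatH (F.P K) (K - n) D X ⟨b.src.shift ν, b.dir⟩ - flatH (F.P K) (K - n) D X b|) ≤
          1 / 4 * MΔ * max (4 * Cd * C * B₃ * ε₁) (θ * ε (K - n))) ∧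
        w 1 b * (w 3 b * |(dcsE (((F.P K).L : ℝ) ^ (K - n)) (dcE (((F.P K).L : ℝ) ^ (K - n)) (WithLp.toLp 2 (flatH (F.P K) (K - n) D X)))) b|) ≤
          1 / 4 * MΔ * max (4 * Cd * C * B₃ * ε₁) (θ * ε (K - n)) ∧
        w 1 b * (w 3 b * (((F.P K).L : ℝ) ^ (K - n)) ^ 2 *
            |∑ ν : Fin (F.P K).d, ((flatH (F.P K) (K - n) D X b - flatH (F.P K) (K - n) D X ⟨b.src.shift ν, b.dir⟩) +
              (flatH (F.P K) (K - n) D X b - flatH (F.P K) (K - n) D X ⟨b.src.unshift ν, b.dir⟩))|) ≤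
          1 / 4 * MΔ * max (4 * Cd * C * B₃ * ε₁) (θ * ε (K - n)) := by
  obtain ⟨Mh₀, R₀, C, δ₀, B₃, hC, hδ₀, hB₃, hmain⟩ := hRowsAt_of_adm22_T4 F
  refine ⟨Mh₀, R₀, C, δ₀, B₃, hC, hδ₀, hB₃, ?_⟩
  intro n K hk1 hk' Mh R a' hMha hMh hR hsize D hDk hAdm w hw
  obtain ⟨-, -, dBI, hcomp, hrow, hdec⟩ := hmain n K hk1 hk' hMha hMh hR hsize D hDk hAdm w hw
  refine ⟨dBI, hcomp, ?_⟩
  intro Cd MΔ ε₁ R' G θ τ ε gap hCd hM hε₁ hεk hεcomp hτ hτδ h2 h163 near X b hnear hfar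
  have hd0 : ∀ c, 0 ≤ dBI b c := fun c => le_trans (by
    unfold distBI
    exact mul_nonneg (pow_nonneg (inv_nonneg.2 (Nat.cast_nonneg _)) _) (B5Prop12FieldsLattice.distSite_nonneg _ _)) (hcomp b c)
  exact rows164_quarter_levelRadii_of_comparable hdec hrow hC hB₃.le hCd hM hε₁ hεk hεcomp hτ hτδ h2 h163 near
    (levWeight_nonneg hw 1 b) hd0 (bondIdx_level_le hDk) hnear hfar

/-- ★ **(164) FOR THE FLAT `H` OF THE ALIGNED CUBE SEQUENCE (144) ON NODE 00's FOUR-TORI** — `hbRows164_levelRadii_of_adm22_T4` at `D := cubeSeqM x₀ (K − n) hk ρ S (F.L·M_h) hM`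
(the `L·M_h`-block-saturated collared tower around the fine base point `x₀`, inner radius `ρ`, collar step `S`), its (2.1)–(2.2) admissibility DISCHARGED by ym3-torus's
carrier-generic `FlatCubeSequenceAdm.adm22_cubeSeqM` under `R·(F.L·M_h) ≤ S`: for every `F : T4Family` there are `M_h⁰, R₀`, `C ≥ 0`, `δ₀ > 0`, `B₃ > 0` such that for all heights
and sizes as in §2, every base point `x₀`, radius `ρ`, step `S ≥ R·F.L·M_h` and every level-weight family of that tower, THERE IS `dBI ≥ distBI` carrying (164) in the
level-dependent currency for the canonical `flatH (F.P K) (K − n) (cubeSeqM …)`, modulo the data (160)∕(155). [cite: Balaban1985Variational, (144) p.300, (160)–(164) pp.303–304; Balaban1984PropagatorsII, (2.1)–(2.2) p.224, Cor. 2.8 (2.150)–(2.151) p.249; Balaban1987RG1, (0.1) p.251] -/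
theorem hbRows164_levelRadii_cubeSeq_T4 (F : T4Family) :
    ∃ (Mh₀ R₀ : ℕ) (C δ₀ B₃ : ℝ), 0 ≤ C ∧ 0 < δ₀ ∧ 0 < B₃ ∧
    ∀ (n K : ℕ) (_ : 1 ≤ K - n) (_ : K - n + 1 ≤ F.m + K) {Mh R a' : ℕ} (_ : Mh = F.L ^ a') (_ : Mh₀ ≤ Mh) (_ : R₀ ≤ R) (_ : a' + 3 ≤ F.m + n)
      (x₀ : Site (F.P K) 0) (hk : K - n ≤ (F.P K).m + (F.P K).K) (ρ S : ℕ) (hM : 1 ≤ F.L * Mh) (_ : R * (F.L * Mh) ≤ S)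
      (w : ℕ → PBond (F.P K) 0 → ℝ) (_ : IsLevWeight (F.P K) (K - n) (cubeSeqM x₀ (K - n) hk ρ S (F.L * Mh) hM) w),
      ∃ dBI : PBond (F.P K) 0 → BondIdx (cubeSeqM x₀ (K - n) hk ρ S (F.L * Mh) hM) → ℝ,
      (∀ b c, distBI (cubeSeqM x₀ (K - n) hk ρ S (F.L * Mh) hM) b c ≤ dBI b c) ∧
      ∀ {Cd MΔ ε₁ R' G θ τ : ℝ} {ε : ℕ → ℝ} {gap : ℕ}
        (_ : 0 ≤ Cd) (_ : 0 ≤ MΔ) (_ : 0 ≤ ε₁) (_ : 0 ≤ ε (K - n)) (_ : ∀ j, j < K - n → ε j ≤ 2 * ε (j + 1))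
        (_ : 0 ≤ τ) (_ : τ ≤ δ₀ / 2) (_ : 2 ≤ Real.exp (τ * G))
        (_ : 4 * Cd * C * B₃ * (Real.exp (-((δ₀ / 2 - τ) * R')) * (2 : ℝ) ^ gap) ≤ θ)
        (near : BondIdx (cubeSeqM x₀ (K - n) hk ρ S (F.L * Mh) hM) → Prop)
        {X : BondIdx (cubeSeqM x₀ (K - n) hk ρ S (F.L * Mh) hM) → ℝ} {b : PBond (F.P K) 0}
        (_ : ∀ c, near c → |X c| ≤ Cd * MΔ * ε₁ * ((dBI b c + 1) * ((F.P K).L : ℝ) ^ ((K - n) - (c.1.1 : ℕ))))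
        (_ : ∀ c, ¬ near c → |X c| ≤ Cd * MΔ * ε (c.1.1 : ℕ) * ((F.P K).L : ℝ) ^ ((K - n) - (c.1.1 : ℕ)) ∧ R' ≤ dBI b c ∧
          G * (((K - n : ℕ) : ℝ) - (c.1.1 : ℕ) - gap) ≤ dBI b c),
        w 1 b * (w 1 b * |flatH (F.P K) (K - n) (cubeSeqM x₀ (K - n) hk ρ S (F.L * Mh) hM) X b|) ≤
          1 / 4 * MΔ * max (4 * Cd * C * B₃ * ε₁) (θ * ε (K - n)) ∧
        (∀ ν : Fin (F.P K).d, w 1 b * (w 2 b * ((F.P K).L : ℝ) ^ (K - n) *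
            |flatH (F.P K) (K - n) (cubeSeqM x₀ (K - n) hk ρ S (F.L * Mh) hM) X ⟨b.src.shift ν, b.dir⟩ -
              flatH (F.P K) (K - n) (cubeSeqM x₀ (K - n) hk ρ S (F.L * Mh) hM) X b|) ≤
          1 / 4 * MΔ * max (4 * Cd * C * B₃ * ε₁) (θ * ε (K - n))) ∧
        w 1 b * (w 3 b * |(dcsE (((F.P K).L : ℝ) ^ (K - n)) (dcE (((F.P K).L : ℝ) ^ (K - n))
            (WithLp.toLp 2 (flatH (F.P K) (K - n) (cubeSeqM x₀ (K - n) hk ρ S (F.L * Mh) hM) X)))) b|) ≤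
          1 / 4 * MΔ * max (4 * Cd * C * B₃ * ε₁) (θ * ε (K - n)) ∧
        w 1 b * (w 3 b * (((F.P K).L : ℝ) ^ (K - n)) ^ 2 *
            |∑ ν : Fin (F.P K).d, ((flatH (F.P K) (K - n) (cubeSeqM x₀ (K - n) hk ρ S (F.L * Mh) hM) X b -
                flatH (F.P K) (K - n) (cubeSeqM x₀ (K - n) hk ρ S (F.L * Mh) hM) X ⟨b.src.shift ν, b.dir⟩) +
              (flatH (F.P K) (K - n) (cubeSeqM x₀ (K - n) hk ρ S (F.L * Mh) hM) X b -
                flatH (F.P K) (K - n) (cubeSeqM x₀ (K - n) hk ρ S (F.L * Mh) hM) X ⟨b.src.unshift ν, b.dir⟩))|) ≤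
          1 / 4 * MΔ * max (4 * Cd * C * B₃ * ε₁) (θ * ε (K - n)) := by
  obtain ⟨Mh₀, R₀, C, δ₀, B₃, hC, hδ₀, hB₃, hmain⟩ := hbRows164_levelRadii_of_adm22_T4 F
  refine ⟨Mh₀, R₀, C, δ₀, B₃, hC, hδ₀, hB₃, ?_⟩
  intro n K hk1 hk' Mh R a' hMha hMh hR hsize x₀ hk ρ S hM hRS w hw
  exact hmain n K hk1 hk' hMha hMh hR hsize (cubeSeqM x₀ (K - n) hk ρ S (F.L * Mh) hM) rfl (adm22_cubeSeqM x₀ hk ρ hM hRS) w hw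

end Summit.QuantumFields.YangMills.Theorems.K0S5HBRowsAtRecordTori

end
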